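import Summits.HodgeConjecture.CorCM.MultiFieldWeilTwoTransitiveTower
import Summits.HodgeConjecture.CorCM.MultiFieldWeilPrimeTower
import HarnessLib

/-!
# MULTI-FIELD WEIL ENGINE — THE 2-TRANSITIVE TOWER OVER ONE-MEMBER FIELDS OF PAIRWISE COPRIME DEGREES: the tower slots are peeled by design separation relative to the
# low fields, the low fields (one member over `τ`, pairwise coprime relative degrees — no 2-transitivity asked of them) are finished by joint set-transitivity

Cell `pub-hodgecm2` (COR-CM), seat b30 gen 30 (2026-08-24); count-neutral own lane MULTI-FIELD WEIL ENGINE (stem `MultiFieldWeil*`), sequel of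
`CorCM/MultiFieldWeilTwoTransitiveTower.lean` (`const_of_signed_twoTransitiveTower`, `twoTransitiveRel_realisedTuples`) and `CorCM/MultiFieldWeilPrimeTower.lean`
(`exists_forall_mem_of_coprime_on`).  Theorems only; no definition, no named fact of its own, no `sorry`.  HONEST FRAMING: the general headline is CONDITIONAL on the
displayed single-slot Weil spaces; the Markman form is conditional ONLY on Markman's fourfold and hyperbolic-sixfold theorems.  `HC_CM` is NOT proved and not asserted.

THE POINT.  In `MultiFieldWeilTwoTransitiveTower` EVERY field must be moved 2-transitively (relative to its predecessors); a sextic CM field `k·F` with `F` a CYCLIC cubic is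
not (its slot image is `C₃`).  Fields with ONE member over `τ` and pairwise coprime relative degrees need nothing of the kind: put them in the low set `L` (their sizes are
unrestricted — `const_of_signed_twoTransitiveTower` imposes no size order), peel the tower slots by automorphisms of `ℂ/k` FIXING the `τ`-embeddings of the low fields
and of the earlier tower fields and moving the slot 2-transitively, then finish `L` by joint set-transitivity (coprime orbit sizes, `exists_forall_mem_of_coprime_on`).
* §1 **`const_of_signed_twoTransitiveTower_coprime`** (abstract), §2 **`exists_hasDefectsG_realisedTuples_of_twoTransitiveTower_oneMember`** (defect law),
* §3 **`hodgeConjectureFor_biproduct_comp_of_twoTransitiveTower_oneMember_intrinsic`** (GIVEN the single-slot Weil spaces) and the Markman-only form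
  **`hodgeConjectureFor_biproduct_comp_of_twoTransitiveTower_oneMember_markman`**: low fields sextic `(1,2)` / octic `(1,3)` of coprime relative degrees `3, 4` (at most one
  of each), tower fields sextic / octic / decic with `(n, p) ∈ {(3,1), (4,1), (4,2), (5,2)}` relatively 2-transitive — HC of every product of copies GIVEN ONLY Markman 4 + 6.
[cite: DixonMortimer1996, §1.6 and §2.1] [cite: MoonenZarhin1995Duke, Thm. 2.4] [cite: Shimura1998, §18.2 Lemma (i)] [cite: Pohlmann1968, Thm 1]
[cite: Markman2025SurveySecant, Thm. 1.2] [cite: Markman2025SecantWeil, Thm 1.5.1] [cite: MumfordAV1970, §19]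

## References
* [DixonMortimer1996] J. D. Dixon, B. Mortimer, *Permutation Groups*, GTM 163, §1.6, §2.1.  [MoonenZarhin1995Duke] B. Moonen, Yu. Zarhin, Duke Math. J. 77 (1995),
  Thm. 2.4.  [Shimura1998] G. Shimura, *Abelian varieties with CM and modular functions*, §18.2 Lemma (i).  [Pohlmann1968] H. Pohlmann, Ann. of Math. 88 (1968),
  Thm 1.  [Markman2025SurveySecant] E. Markman, arXiv:2509.23403, Thm. 1.2.  [Markman2025SecantWeil] E. Markman, Cycles on abelian 2n-folds of Weil type from secant
  sheaves on abelian n-folds, Thm 1.5.1.  [MumfordAV1970] D. Mumford, *Abelian Varieties*, §19.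
-/

noncomputable section

open CategoryTheory CategoryTheory.Limits NumberField

namespace Summit.HodgeConjecture.CorCM.MultiFieldWeil

open Finset
open Literature.AlgebraicGeometry Literature.AlgebraicGeometry.Motives Literature.AlgebraicGeometry.HodgeTheory
open Literature.AlgebraicGeometry.ComplexMultiplication (IsCMTypeRealisation)
open Literature.AlgebraicTopology.SingularHomology
open Literature.NumberTheory.ComplexMultiplication
open Summit.HodgeConjecture.CorCM.Census.MultiFieldWeil

open scoped Classical

/-! ## §1 Abstract: the 2-transitive tower over coprime orbits -/

section Tower

variable {r : ℕ} {n : Fin r → ℕ} {R : Finset (PermsG n)} {P : ∀ m : Fin r, Finset (Fin (n m))}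

/-- **THE 2-TRANSITIVE TOWER OVER COPRIME ORBITS (abstract `R`).**  Under the hypotheses of `const_of_signed_twoTransitiveTower`, if moreover the position-set orbits of the
slots of `L` have pairwise coprime sizes and separate, then EVERY slot has constant defect. [cite: DixonMortimer1996, §1.6 and §2.1] [cite: MoonenZarhin1995Duke, Thm. 2.4] -/
theorem const_of_signed_twoTransitiveTower_coprime (hmul : ∀ π ∈ R, ∀ π' ∈ R, π * π' ∈ R) (hinv : ∀ π ∈ R, π⁻¹ ∈ R) (hne : R.Nonempty)
    (L : Finset (Fin r)) (prio : Fin r → ℕ) (hinj : ∀ m m', m ∉ L → m' ∉ L → prio m = prio m' → m = m')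
    (hP0 : ∀ m, m ∉ L → (P m).Nonempty) (hPn : ∀ m, m ∉ L → (P m).card < n m)
    (h2 : ∀ m₀, m₀ ∉ L → ∀ a b a' b' : Fin (n m₀), a ≠ b → a' ≠ b' →
      ∃ ρ ∈ R, (∀ m ∈ L, ρ m = 1) ∧ (∀ m, m ∉ L → prio m < prio m₀ → ρ m = 1) ∧ ρ m₀ a = a' ∧ ρ m₀ b = b')
    (hcop : ∀ m ∈ L, ∀ m' ∈ L, m ≠ m' → ((orbitG R P m).card).Coprime ((orbitG R P m').card))
    (hsep : ∀ m ∈ L, ∀ f : Fin (n m) → ℤ, (∀ Q ∈ orbitG R P m, ∑ a ∈ Q, f a = ∑ a ∈ P m, f a) → ∀ a b : Fin (n m), f a = f b)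
    {u : ℤ} {d : ∀ m : Fin r, Fin (n m) → ℤ}
    (h : ∀ π ∈ R, u + ∑ m : Fin r, ∑ a : Fin (n m), (if π m a ∈ P m then d m a else -d m a) = 0) :
    ∀ (m : Fin r) (a b : Fin (n m)), d m a = d m b := by
  have htop := const_of_signed_twoTransitiveTower hmul hinv hne L prio hinj hP0 hPn h2 h
  have hlow : ∀ m ∈ L, ∀ a b : Fin (n m), d m a = d m b :=
    const_of_signed_jointSetTransitive_on (R := R) (P := P) (𝒳 := orbitG R P) L (fun m _ => self_mem_orbitG (one_mem_of_closed hmul hinv hne) m)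
      (fun Q hQ => exists_forall_mem_of_coprime_on hmul hinv hne L hcop Q hQ) hsep (fun m hm => htop m hm) h
  intro m
  by_cases hm : m ∈ L
  · exact hlow m hm
  · exact htop m hm

end Tower

/-! ## §2 The defect law -/

section Realised

variable {I : Type} {r : ℕ} {Kf : I → Type} [∀ i, Field (Kf i)] [∀ i, NumberField (Kf i)] {i₀ : I} {is : Fin r → I} {n : Fin r → ℕ}
  {e : ∀ m : Fin r, (Kf (is m) →+* ℂ) ≃ Fin (n m) × Bool} {τ : Kf i₀ →+* ℂ} {im : ∀ m : Fin r, Kf i₀ →+* Kf (is m)}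
  (he_sign : ∀ (m : Fin r) (s : Kf (is m) →+* ℂ), (e m s).2 = true ↔ s.comp (im m) = τ)

include he_sign in
/-- **THE DEFECT LAW — 2-TRANSITIVE TOWER OVER ONE-MEMBER FIELDS OF PAIRWISE COPRIME DEGREES.**  `L`: one-member position sets, pairwise coprime sizes (any sizes);
outside `L`: proper non-empty position sets (`0 < |P m| < n m`) and, in index order, relative 2-transitivity: every two pairs of distinct `τ`-embeddings of `K_{m₀}` are
interchanged by an automorphism of `ℂ` over `τ(k)` FIXING all `τ`-embeddings of the fields of `L` and of the `K_m`, `m ∉ L`, `m < m₀` (`h2T`).  Every configuration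
balanced under the realised tuples obeys the defect law with any `c m = n m − 2|P m|` (as integers). [cite: MoonenZarhin1995Duke, Thm. 2.4] [cite: DixonMortimer1996, §1.6 and §2.1] -/
theorem exists_hasDefectsG_realisedTuples_of_twoTransitiveTower_oneMember (L : Finset (Fin r))
    (hcop : ∀ m ∈ L, ∀ m' ∈ L, m ≠ m' → (n m).Coprime (n m'))
    {P : ∀ m : Fin r, Finset (Fin (n m))} (hP1 : ∀ m ∈ L, ∃ p : Fin (n m), P m = {p})
    (hP0 : ∀ m, m ∉ L → (P m).Nonempty) (hPn : ∀ m, m ∉ L → (P m).card < n m)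
    (h2T : ∀ m₀, m₀ ∉ L → ∀ s t s' t' : Kf (is m₀) →+* ℂ, s.comp (im m₀) = τ → t.comp (im m₀) = τ → s'.comp (im m₀) = τ → t'.comp (im m₀) = τ →
      s ≠ t → s' ≠ t' → ∃ ρ : ℂ ≃+* ℂ,
        (∀ m : Fin r, (m ∈ L ∨ (m ∉ L ∧ m < m₀)) → ∀ u : Kf (is m) →+* ℂ, u.comp (im m) = τ → (ρ : ℂ →+* ℂ).comp u = u) ∧
        (ρ : ℂ →+* ℂ).comp s = s' ∧ (ρ : ℂ →+* ℂ).comp t = t')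
    (c : Fin r → ℕ) (hc : ∀ m, ((c m : ℕ) : ℤ) = (n m : ℤ) - 2 * (P m).card)
    {α : Type} (v : α → PtG n) (T : Finset α) (hT : ModelBalancedG P (realisedTuples e τ) v T) :
    ∃ t : Fin r → ℤ, HasDefectsG c v T t := by
  have hmul : ∀ π ∈ realisedTuples e τ, ∀ π' ∈ realisedTuples e τ, π * π' ∈ realisedTuples e τ :=
    fun π hπ π' hπ' => mul_mem_realisedTuples e τ hπ hπ'
  have hinv : ∀ π ∈ realisedTuples e τ, π⁻¹ ∈ realisedTuples e τ := fun π hπ => inv_mem_realisedTuples hπ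
  have hne : (realisedTuples e τ).Nonempty := realisedTuples_nonempty (e := e) he_sign
  have htrans : ∀ (m : Fin r) (a b : Fin (n m)), ∃ π ∈ realisedTuples e τ, π m a = b := fun m a b =>
    transitive_realisedTuples (e := e) he_sign m a b
  have hconst := const_of_signed_twoTransitiveTower_coprime (P := P) hmul hinv hne L (fun m => (m : ℕ)) (fun m m' _ _ h => Fin.ext h) hP0 hPn
    (fun m₀ hm₀ a b a' b' hab hab' => by
      obtain ⟨π, hπ, hπS, hπa, hπb⟩ := twoTransitiveRel_realisedTuples (e := e) he_sign (univ.filter fun m => m ∈ L ∨ (m ∉ L ∧ m < m₀)) m₀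
        (fun s t s' t' hs ht hs' ht' hst hst' => by
          obtain ⟨ρ, hfix, hρs, hρt⟩ := h2T m₀ hm₀ s t s' t' hs ht hs' ht' hst hst'
          exact ⟨ρ, fun m hm u hu => hfix m (Finset.mem_filter.1 hm).2 u hu, hρs, hρt⟩) hab hab'
      exact ⟨π, hπ, fun m hm => hπS m (Finset.mem_filter.2 ⟨Finset.mem_univ _, Or.inl hm⟩),
        fun m hmL hlt => hπS m (Finset.mem_filter.2 ⟨Finset.mem_univ _, Or.inr ⟨hmL, hlt⟩⟩), hπa, hπb⟩)
    (fun m hm m' hm' hmm' => by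
      obtain ⟨p, hp⟩ := hP1 m hm
      obtain ⟨p', hp'⟩ := hP1 m' hm'
      rw [card_orbitG_singleton hp (htrans m), card_orbitG_singleton hp' (htrans m')]
      exact hcop m hm m' hm' hmm')
    (fun m hm f hf => by
      obtain ⟨p, hp⟩ := hP1 m hm
      exact sep_of_singletons (fun a => singleton_mem_orbitG hp (htrans m) a) f hf)
    fun π hπ => signed_of_modelBalancedG (realisedTuples e τ) v hT hπ
  obtain ⟨t, hd, he'⟩ := exists_defects_of_const (P := P) hne hconst fun π hπ => signed_of_modelBalancedG (realisedTuples e τ) v hT hπ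
  refine ⟨t, fun m a => hd m a, ?_⟩
  rw [he']
  exact Finset.sum_congr rfl fun m _ => by rw [hc m]

end Realised

/-! ## §3 The headlines -/

section Headline

variable {I : Type} {r : ℕ} {Kf : I → Type} [∀ i, Field (Kf i)] [∀ i, NumberField (Kf i)] [∀ i, IsCMField (Kf i)]
  {i₀ : I} {is : Fin r → I} {n : Fin r → ℕ} {τ : Kf i₀ →+* ℂ}
  {A : Fin (r + 1) → AbelianVariety ℂ} {Φ : ∀ j : Fin (r + 1), CMType (Kf (mfSlots i₀ is j))}
  {ι : ∀ j, 𝓞 (Kf (mfSlots i₀ is j)) →+* End (A j)}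
  {θ : ∀ j, Kf (mfSlots i₀ is j) →+* Module.End ℂ (complexBetti (A j).X 1)}

/-- **HEADLINE — THE 2-TRANSITIVE TOWER OVER ONE-MEMBER FIELDS OF PAIRWISE COPRIME DEGREES (intrinsic form).**  `E = A 0 ⊨ (k; {τ})`, `B_m = A (m+1) ⊨ (K_m; Φ (m+1))`,
`[K_m : ℚ] = 2 n_m`, `p_m` members over `τ` (`0 < p_m`, `2p_m ≤ n_m`).  Slots of `L`: `p_m = 1`, `n_m` pairwise coprime (any sizes, nothing else).  Slots outside `L`: in index
order, every two pairs of distinct `τ`-embeddings of `K_{m₀}` are interchanged by an automorphism of `ℂ` over `τ(k)` FIXING all `τ`-embeddings of the fields of `L` and of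
the earlier tower fields (`h2T`).  Then the Hodge conjecture holds for EVERY product of copies `⨁_j A(κ j)` GIVEN the single-slot Weil spaces `hW m`.  `HC_CM` is NOT asserted.
[cite: Pohlmann1968, Thm 1] [cite: MoonenZarhin1995Duke, Thm. 2.4] [cite: DixonMortimer1996, §1.6 and §2.1] [cite: Shimura1998, §18.2 Lemma (i)] -/
theorem hodgeConjectureFor_biproduct_comp_of_twoTransitiveTower_oneMember_intrinsic (p : Fin r → ℕ) (L : Finset (Fin r))
    (hcop : ∀ m ∈ L, ∀ m' ∈ L, m ≠ m' → (n m).Coprime (n m')) (hp1 : ∀ m ∈ L, p m = 1) (hp0 : ∀ m, 0 < p m) (hpn : ∀ m, 2 * p m ≤ n m)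
    {N : ℕ} (κ : Fin N → Fin (r + 1)) (h2 : Module.finrank ℚ (Kf i₀) = 2) (hdeg : ∀ m : Fin r, Module.finrank ℚ (Kf (is m)) = 2 * n m)
    (im : ∀ m : Fin r, Kf i₀ →+* Kf (is m))
    (h2T : ∀ m₀, m₀ ∉ L → ∀ s t s' t' : Kf (is m₀) →+* ℂ, s.comp (im m₀) = τ → t.comp (im m₀) = τ → s'.comp (im m₀) = τ → t'.comp (im m₀) = τ →
      s ≠ t → s' ≠ t' → ∃ ρ : ℂ ≃+* ℂ,
        (∀ m : Fin r, (m ∈ L ∨ (m ∉ L ∧ m < m₀)) → ∀ u : Kf (is m) →+* ℂ, u.comp (im m) = τ → (ρ : ℂ →+* ℂ).comp u = u) ∧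
        (ρ : ℂ →+* ℂ).comp s = s' ∧ (ρ : ℂ →+* ℂ).comp t = t')
    {δ : 𝓞 (Kf i₀)} {d : ℕ} (hτ : τ (δ : Kf i₀) = Complex.I * (Real.sqrt d : ℂ))
    (hA : ∀ j, IsCMTypeRealisation (Φ j) (A j) (ι j) (θ j))
    (hΨ : ∀ σ : Kf i₀ →+* ℂ, σ ∈ (Φ 0).1 ↔ σ = τ)
    (hp : ∀ m : Fin r, (Finset.univ.filter fun s : Kf (is m) →+* ℂ => s.comp (im m) = τ ∧ s ∈ (Φ m.succ).1).card = p m)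
    (hW : ∀ m : Fin r, weilClassesOf (⨁ fun i => A (partSlots (n m - 2 * p m) m i))
      (biproduct.map fun i => ι (partSlots (n m - 2 * p m) m i) (δfam im δ (partSlots (n m - 2 * p m) m i))) (n m - p m) d ≤
      algebraicClasses (⨁ fun i => A (partSlots (n m - 2 * p m) m i)).X (n m - p m)) :
    HodgeConjectureFor (⨁ fun j => A (κ j)).dim (⨁ fun j => A (κ j)).X := by
  have hττ : ComplexEmbedding.conjugate τ ≠ τ := QuarticCM.conjugate_ne τ
  have hk : ∀ σ : Kf i₀ →+* ℂ, σ = τ ∨ σ = ComplexEmbedding.conjugate τ := fun σ => QuarticCM.eq_or_eq_conjugate_of_quadratic h2 τ σ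
  have hfr : ∀ m : Fin r, ∃ e : (Kf (is m) →+* ℂ) ≃ Fin (n m) × Bool, (∀ s, (e s).2 = true ↔ s.comp (im m) = τ) ∧
      ∀ s, e (ComplexEmbedding.conjugate s) = ((e s).1, !(e s).2) := fun m => exists_signFrame (hdeg m) h2 (im m) hττ hk
  choose e he_sign he_conj using hfr
  let P : ∀ m : Fin r, Finset (Fin (n m)) := fun m => Finset.univ.filter fun a : Fin (n m) => (e m).symm (a, true) ∈ (Φ m.succ).1
  have hcard : ∀ m, (P m).card = p m := fun m => (card_posSet (he_sign m) (Φ m.succ)).trans (hp m)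
  exact hodgeConjectureFor_biproduct_comp_of_defectLawG (is := is) P (fun m => n m - 2 * p m) (fun m => n m - p m)
    (fun m => by have := hpn m; omega) (fun m => by have := hp0 m; have := hpn m; omega) κ h2 im hτ hA e he_sign he_conj hΨ
    (fun m s => mem_iff_snd_eq_decide_mem_posSet (he_conj m) (Φ m.succ) s)
    (fun v T hT => exists_hasDefectsG_realisedTuples_of_twoTransitiveTower_oneMember (e := e) he_sign L hcop
      (fun m hm => Finset.card_eq_one.1 (by rw [hcard m, hp1 m hm]))
      (fun m _ => Finset.card_pos.1 (by rw [hcard m]; exact hp0 m)) (fun m _ => by have := hpn m; have := hp0 m; rw [hcard m]; omega) h2T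
      (fun m => n m - 2 * p m) (fun m => by rw [hcard m, Nat.cast_sub (hpn m)]; push_cast; ring) v T hT) hW

/-- **HEADLINE — SEXTIC / OCTIC / DECIC FIELDS, a 2-transitive tower over at most one one-member field per coprime relative degree, GIVEN ONLY MARKMAN'S TWO THEOREMS.**
`(n_m, p_m) ∈ {(3,1), (4,1), (4,2), (5,2)}`; the slots of `L` have `p_m = 1` and pairwise coprime `n_m` (so: at most one sextic `(1,2)` and one octic `(1,3)` field — e.g. a cyclic
sextic, whose slot image is not 2-transitive); the other fields satisfy the relative 2-transitivity `h2T`.  HC of EVERY product of copies of `E` and the `B_m`.  `HC_CM` is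
NOT asserted. [cite: Markman2025SurveySecant, Thm. 1.2] [cite: Markman2025SecantWeil, Thm 1.5.1] [cite: Pohlmann1968, Thm 1] [cite: DixonMortimer1996, §2.1] -/
theorem hodgeConjectureFor_biproduct_comp_of_twoTransitiveTower_oneMember_markman (hW4 : Markman2025_weilClasses_algebraic_abelianFourfold)
    (hM6 : Markman2025_weilClasses_algebraic_hyperbolicSixfold) (n p : Fin r → ℕ) (L : Finset (Fin r))
    (hnp : ∀ m, (n m = 3 ∧ p m = 1) ∨ (n m = 4 ∧ p m = 1) ∨ (n m = 4 ∧ p m = 2) ∨ (n m = 5 ∧ p m = 2))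
    (hcop : ∀ m ∈ L, ∀ m' ∈ L, m ≠ m' → (n m).Coprime (n m')) (hp1 : ∀ m ∈ L, p m = 1)
    {N : ℕ} (κ : Fin N → Fin (r + 1)) (h2 : Module.finrank ℚ (Kf i₀) = 2) (hdeg : ∀ m : Fin r, Module.finrank ℚ (Kf (is m)) = 2 * n m)
    (im : ∀ m : Fin r, Kf i₀ →+* Kf (is m)) (hA : ∀ j, IsCMTypeRealisation (Φ j) (A j) (ι j) (θ j)) (hΨ : ∀ σ : Kf i₀ →+* ℂ, σ ∈ (Φ 0).1 ↔ σ = τ)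
    (hp : ∀ m : Fin r, (Finset.univ.filter fun s : Kf (is m) →+* ℂ => s.comp (im m) = τ ∧ s ∈ (Φ m.succ).1).card = p m)
    (h2T : ∀ m₀, m₀ ∉ L → ∀ s t s' t' : Kf (is m₀) →+* ℂ, s.comp (im m₀) = τ → t.comp (im m₀) = τ → s'.comp (im m₀) = τ → t'.comp (im m₀) = τ →
      s ≠ t → s' ≠ t' → ∃ ρ : ℂ ≃+* ℂ,
        (∀ m : Fin r, (m ∈ L ∨ (m ∉ L ∧ m < m₀)) → ∀ u : Kf (is m) →+* ℂ, u.comp (im m) = τ → (ρ : ℂ →+* ℂ).comp u = u) ∧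
        (ρ : ℂ →+* ℂ).comp s = s' ∧ (ρ : ℂ →+* ℂ).comp t = t') :
    HodgeConjectureFor (⨁ fun j => A (κ j)).dim (⨁ fun j => A (κ j)).X := by
  obtain ⟨δ₀, d, hd, hδ₀⟩ := CyclicSextic.exists_sq_eq_neg_nat_of_isTotallyComplex (Kf i₀) h2
  obtain ⟨δ, hδ, hτ⟩ := OcticCurveFourfold.exists_delta_of_mem h2 hd hδ₀ τ
  refine hodgeConjectureFor_biproduct_comp_of_twoTransitiveTower_oneMember_intrinsic (is := is) (n := n) p L hcop hp1 (fun m => ?_) (fun m => ?_) κ h2 hdeg im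
    h2T hτ hA hΨ hp fun m => weilHyp_of_markman_intrinsic hW4 hM6 m (hnp m) (hdeg m) h2 hd hδ hA hΨ (hp m)
  · rcases hnp m with ⟨-, h⟩ | ⟨-, h⟩ | ⟨-, h⟩ | ⟨-, h⟩ <;> omega
  · rcases hnp m with ⟨h, h'⟩ | ⟨h, h'⟩ | ⟨h, h'⟩ | ⟨h, h'⟩ <;> omega

/-- **… and for every abelian variety DOMINATED by such a product.** `HC_CM` is NOT asserted. [cite: MumfordAV1970, §19] [cite: Markman2025SurveySecant, Thm. 1.2]
[cite: Markman2025SecantWeil, Thm 1.5.1] -/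
theorem hodgeConjectureFor_of_avDominatedBy_comp_of_twoTransitiveTower_oneMember_markman (hW4 : Markman2025_weilClasses_algebraic_abelianFourfold)
    (hM6 : Markman2025_weilClasses_algebraic_hyperbolicSixfold) (n p : Fin r → ℕ) (L : Finset (Fin r))
    (hnp : ∀ m, (n m = 3 ∧ p m = 1) ∨ (n m = 4 ∧ p m = 1) ∨ (n m = 4 ∧ p m = 2) ∨ (n m = 5 ∧ p m = 2))
    (hcop : ∀ m ∈ L, ∀ m' ∈ L, m ≠ m' → (n m).Coprime (n m')) (hp1 : ∀ m ∈ L, p m = 1)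
    {N : ℕ} (κ : Fin N → Fin (r + 1)) (h2 : Module.finrank ℚ (Kf i₀) = 2) (hdeg : ∀ m : Fin r, Module.finrank ℚ (Kf (is m)) = 2 * n m)
    (im : ∀ m : Fin r, Kf i₀ →+* Kf (is m)) (hA : ∀ j, IsCMTypeRealisation (Φ j) (A j) (ι j) (θ j)) (hΨ : ∀ σ : Kf i₀ →+* ℂ, σ ∈ (Φ 0).1 ↔ σ = τ)
    (hp : ∀ m : Fin r, (Finset.univ.filter fun s : Kf (is m) →+* ℂ => s.comp (im m) = τ ∧ s ∈ (Φ m.succ).1).card = p m)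
    (h2T : ∀ m₀, m₀ ∉ L → ∀ s t s' t' : Kf (is m₀) →+* ℂ, s.comp (im m₀) = τ → t.comp (im m₀) = τ → s'.comp (im m₀) = τ → t'.comp (im m₀) = τ →
      s ≠ t → s' ≠ t' → ∃ ρ : ℂ ≃+* ℂ,
        (∀ m : Fin r, (m ∈ L ∨ (m ∉ L ∧ m < m₀)) → ∀ u : Kf (is m) →+* ℂ, u.comp (im m) = τ → (ρ : ℂ →+* ℂ).comp u = u) ∧
        (ρ : ℂ →+* ℂ).comp s = s' ∧ (ρ : ℂ →+* ℂ).comp t = t')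
    {X : AbelianVariety ℂ} (hX : Domination.AVDominatedBy X (⨁ fun j => A (κ j))) : HodgeConjectureFor X.dim X.X :=
  Domination.hodgeConjectureFor_of_avDominatedBy
    (hodgeConjectureFor_biproduct_comp_of_twoTransitiveTower_oneMember_markman hW4 hM6 n p L hnp hcop hp1 κ h2 hdeg im hA hΨ hp h2T) hX

end Headline

end Summit.HodgeConjecture.CorCM.MultiFieldWeil

end
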